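import Mathlib.Analysis.Calculus.ImplicitContDiff
import Mathlib.Analysis.Calculus.ContDiff.Operations
import Mathlib.Analysis.Calculus.Deriv.Pow
import Mathlib.Analysis.Calculus.Deriv.Prod
import Mathlib.Analysis.Calculus.Deriv.Pi
import Mathlib.Analysis.Calculus.Deriv.Mul
import Mathlib.LinearAlgebra.Matrix.ToLin
import Mathlib.LinearAlgebra.Matrix.Symmetric
import Mathlib.LinearAlgebra.FiniteDimensional.Lemmas
import Mathlib.Topology.Instances.Matrix
import HarnessLib

/-!
# Route `AnisotropyChord`, crux `ChordXY` (stmt-HubbardSuperconductivity-8146), line `doob-johnson-chord`,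
# PLAN A / H1 infrastructure: smooth dependence of the positive bottom eigenvector (Perron branch) of a
# `C^∞` family of real symmetric matrices, with the Hellmann–Feynman and first-order perturbation
# identities (general matrix analysis; support file, lead-8146-chordxy g1)

Namespace `…Theorems.AnisotropyChord.PerronBranch`; theorems only; no definition, no named fact, no
`sorry`; imports Mathlib only (re-homeable to `Literature/Analysis/Matrix` by a librarian — every
statement is textbook, Kato II-§5–6).  HONEST: pure linear algebra/calculus; nothing here is specific to
the XXZ model, proves `ChordXY`, or advances superconductivity in the Hubbard model.  Let `ι` be a finite index type
and `T : ℝ → Matrix ι ι ℝ` an entrywise `C^∞` family of SYMMETRIC matrices such that every `T θ` has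
a unit eigenvector `n` with ALL ENTRIES POSITIVE whose eigenvalue `λ` is strictly below the quadratic
form on `n^⊥` (`λ‖v‖² < ⟨v, T θ v⟩` for `0 ≠ v ⊥ n`: `λ` is the SIMPLE bottom eigenvalue and `n` its
Perron vector — the situation of an irreducible stoquastic / Z-matrix family, Perron–Frobenius).
Then (`exists_contDiff_pos_bottom_eigenvector`) the positive unit bottom eigenvector `N θ` and its
eigenvalue `Λ θ` are `C^∞` functions of `θ`.

Proof (Kato II-§5–6 for a simple eigenvalue, elementary form; the same implicit-function argument as
`NegativeEigenvectorSmooth.lean`, which treats a signature-`(2,1)` family on `ℝ³`): the eigenpair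
`(n, λ)` at `θ₀` is a zero of `f(θ; v, μ) = (T(θ) v - μ v, ⟨v, v⟩) - (0, 1)` whose partial derivative
in `(v, μ)`, `(h, η) ↦ ((T₀ - λ) h - η n, 2⟨n, h⟩)` (`fderiv_inr_eigenpairMap`), is injective by the gap
(`gap_linearization_injective`), hence invertible; Mathlib's `C^n` implicit function theorem
(`ContDiffAt.implicitFunction`) continues the eigenpair smoothly; by continuity the continued vector
keeps positive entries near `θ₀`, and a positive unit eigenvector IS the Perron pair
(`pos_eigenvector_unique`: it pairs positively with `n`, so it has the eigenvalue `λ`, and the gap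
kills its `n^⊥` component), so the Perron pair is smooth at `θ₀`.

Identities along a differentiable unit eigenpair branch (`T` entrywise differentiable, `T θ` symmetric):
* `hasDerivAt_eigenvalue_eq_hellmannFeynman` — `Λ' = ⟨N, T' N⟩` (Hellmann–Feynman);
* `deriv_eigenvector_orthogonal` — `⟨N', N⟩ = 0`;
* `firstOrder_eigenvector_equation` — `(T - Λ) N' = Λ' N - T' N` (the first-order perturbation
  equation; with the gap it determines `N' ⊥ N`, i.e. `N' = -R (T' - Λ') N` with `R` the reduced
  resolvent, Kato II-(2.14)/(2.33) — the resolvent itself is not introduced);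
* `hasDerivAt_quadraticForm_of_isSymm` — for a fixed symmetric `O`, `d/dθ ⟨N, O N⟩ = 2⟨N', O N⟩`.

## References
* T. Kato, *Perturbation Theory for Linear Operators*, Springer 1966, Ch. II §1.1, §2.2 (2.14),
  §5.4 Thm 5.4, §6.1–6.2 (analytic eigenprojections and eigenvectors of symmetric families; simple
  eigenvalues). [Kato1966]
* A. Berman, R. J. Plemmons, *Nonnegative Matrices in the Mathematical Sciences* (1979), Ch. 2
  Thm (1.4) (Perron vector of an irreducible nonnegative matrix; uniqueness of positive eigenvectors).
  [BermanPlemmons1979]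
-/

set_option linter.dupNamespace false

noncomputable section

namespace Summit.HubbardSuperconductivity.HubbardSuperconductivity.Theorems.AnisotropyChord.PerronBranch

open _root_.Matrix Filter Topology Set Function
open scoped ContDiff

variable {ι : Type*} [Fintype ι]

/-! ### Static linear algebra at a gapped bottom eigenpair -/

section Static

variable {T : Matrix ι ι ℝ} {n : ι → ℝ} {lam : ℝ}

/-- `⟨v, T w⟩ = ⟨w, T v⟩` for symmetric `T`. [folklore] -/
theorem dotProduct_mulVec_comm_of_isSymm (hT : T.IsSymm) (v w : ι → ℝ) :
    v ⬝ᵥ T *ᵥ w = w ⬝ᵥ T *ᵥ v := by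
  rw [dotProduct_mulVec, ← mulVec_transpose, hT.eq, dotProduct_comm]

/-- `⟨T v, n⟩ = λ ⟨v, n⟩` for an eigenvector `n` of the symmetric `T`. [folklore] -/
theorem mulVec_dotProduct_eigenvector (hT : T.IsSymm) (hTn : T *ᵥ n = lam • n) (v : ι → ℝ) :
    (T *ᵥ v) ⬝ᵥ n = lam * (v ⬝ᵥ n) := by
  rw [dotProduct_comm, dotProduct_mulVec_comm_of_isSymm hT, hTn, dotProduct_smul, smul_eq_mul,
    dotProduct_comm]

/-- **Injectivity of the linearised eigenpair map at a gapped eigenpair**: if `n` is a unit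
eigenvector of the symmetric `T` with eigenvalue `λ` STRICTLY below the form on `n^⊥`, then
`(T - λ) h = η n`, `h ⊥ n` force `h = 0`, `η = 0`. [cite: Kato1966, II-§2.2 (reduced resolvent on `(1-P)X`)] -/
theorem gap_linearization_injective (hT : T.IsSymm) (hn1 : n ⬝ᵥ n = 1) (hTn : T *ᵥ n = lam • n)
    (hgap : ∀ v, v ⬝ᵥ n = 0 → v ≠ 0 → lam * (v ⬝ᵥ v) < v ⬝ᵥ T *ᵥ v) {h : ι → ℝ} {η : ℝ}
    (h1 : T *ᵥ h - lam • h = η • n) (h2 : h ⬝ᵥ n = 0) : h = 0 ∧ η = 0 := by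
  -- `η = ⟨(T - λ) h, n⟩ = ⟨(T - λ) n, h⟩ = 0`
  have hη : η = 0 := by
    have h3 := congrArg (fun x ↦ x ⬝ᵥ n) h1
    beta_reduce at h3
    rw [sub_dotProduct, mulVec_dotProduct_eigenvector hT hTn, h2, smul_dotProduct, h2,
      smul_dotProduct, hn1] at h3
    simp only [mul_zero, smul_eq_mul, sub_self, mul_one] at h3
    exact h3.symm
  refine ⟨?_, hη⟩
  by_contra hh
  rw [hη, zero_smul, sub_eq_zero] at h1
  -- `T h = λ h` with `h ⊥ n`, `h ≠ 0` contradicts the gap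
  have hq : h ⬝ᵥ T *ᵥ h = lam * (h ⬝ᵥ h) := by rw [h1, dotProduct_smul, smul_eq_mul]
  have := hgap h h2 hh
  linarith

/-- **A positive unit eigenvector is the Perron pair**: with `n > 0` (entrywise) a gapped unit bottom
eigenvector of the symmetric `T` (eigenvalue `λ`), every unit eigenvector `m` with all entries
positive equals `n`, and its eigenvalue is `λ`. [cite: BermanPlemmons1979, Ch. 2 Thm (1.4)] -/
theorem pos_eigenvector_unique [Nonempty ι] (hT : T.IsSymm) (hn1 : n ⬝ᵥ n = 1)
    (hTn : T *ᵥ n = lam • n) (hnpos : ∀ i, 0 < n i)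
    (hgap : ∀ v, v ⬝ᵥ n = 0 → v ≠ 0 → lam * (v ⬝ᵥ v) < v ⬝ᵥ T *ᵥ v)
    {m : ι → ℝ} {μ : ℝ} (hm1 : m ⬝ᵥ m = 1) (hTm : T *ᵥ m = μ • m) (hmpos : ∀ i, 0 < m i) :
    m = n ∧ μ = lam := by
  set c : ℝ := m ⬝ᵥ n with hc
  have hcpos : 0 < c := by
    rw [hc, dotProduct]
    exact Finset.sum_pos (fun i _ => mul_pos (hmpos i) (hnpos i)) Finset.univ_nonempty
  -- the eigenvalues agree: `μ c = ⟨T m, n⟩ = λ c`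
  have hμ : μ = lam := by
    have h1 : (T *ᵥ m) ⬝ᵥ n = μ * c := by rw [hTm, smul_dotProduct, smul_eq_mul]
    rw [mulVec_dotProduct_eigenvector hT hTn] at h1
    have h2 : (μ - lam) * c = 0 := by rw [sub_mul]; linarith
    rcases mul_eq_zero.1 h2 with h | h
    · linarith
    · exact absurd h hcpos.ne'
  refine ⟨?_, hμ⟩
  -- the `n^⊥` component of `m` is an eigenvector for `λ`, hence zero by the gap
  set v : ι → ℝ := m - c • n with hv
  have hvn : v ⬝ᵥ n = 0 := by
    rw [hv, sub_dotProduct, smul_dotProduct, hn1, smul_eq_mul, mul_one, hc, sub_self]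
  have hTv : T *ᵥ v = lam • v := by
    rw [hv, mulVec_sub, mulVec_smul, hTm, hTn, hμ, smul_sub, smul_comm]
  have hv0 : v = 0 := by
    by_contra hv0
    have hq : v ⬝ᵥ T *ᵥ v = lam * (v ⬝ᵥ v) := by rw [hTv, dotProduct_smul, smul_eq_mul]
    have := hgap v hvn hv0
    linarith
  have hmc : m = c • n := by rw [← sub_eq_zero, ← hv]; exact hv0
  -- `c = 1` from `‖m‖ = 1`, `c > 0`
  have hc1 : c = 1 := by
    have h : c * c = 1 := by
      have := hm1
      rw [hmc, smul_dotProduct, dotProduct_smul, hn1, smul_eq_mul, smul_eq_mul, mul_one] at this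
      exact this
    nlinarith
  rw [hmc, hc1, one_smul]

end Static

/-! ### The eigenpair equation and its smoothness -/

/-- `(θ, v) ↦ T(θ) v` is `C^∞` for an entrywise `C^∞` family of matrices. [folklore] -/
theorem contDiff_mulVec_family {T : ℝ → Matrix ι ι ℝ}
    (hT : ∀ i j, ContDiff ℝ ∞ fun θ ↦ T θ i j) :
    ContDiff ℝ ∞ fun p : ℝ × ((ι → ℝ) × ℝ) ↦ T p.1 *ᵥ p.2.1 := by
  refine contDiff_pi.2 fun i ↦ ?_
  have h : (fun p : ℝ × ((ι → ℝ) × ℝ) ↦ (T p.1 *ᵥ p.2.1) i) =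
      fun p ↦ ∑ j, T p.1 i j * p.2.1 j := by
    funext p; simp [Matrix.mulVec, dotProduct]
  rw [h]
  refine ContDiff.sum fun j _ ↦ ((hT i j).comp contDiff_fst).mul ?_
  exact contDiff_pi.1 (contDiff_fst.comp contDiff_snd) j

/-- The eigenpair map `f(θ; v, μ) = (T(θ) v - μ v, ⟨v, v⟩)` is `C^∞`. [folklore] -/
theorem contDiff_eigenpairMap {T : ℝ → Matrix ι ι ℝ}
    (hT : ∀ i j, ContDiff ℝ ∞ fun θ ↦ T θ i j) :
    ContDiff ℝ ∞ fun p : ℝ × ((ι → ℝ) × ℝ) ↦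
      (T p.1 *ᵥ p.2.1 - p.2.2 • p.2.1, p.2.1 ⬝ᵥ p.2.1) := by
  have hv : ContDiff ℝ ∞ fun p : ℝ × ((ι → ℝ) × ℝ) ↦ p.2.1 := contDiff_fst.comp contDiff_snd
  have hμ : ContDiff ℝ ∞ fun p : ℝ × ((ι → ℝ) × ℝ) ↦ p.2.2 := contDiff_snd.comp contDiff_snd
  refine ((contDiff_mulVec_family hT).sub (hμ.smul hv)).prodMk ?_
  have h : (fun p : ℝ × ((ι → ℝ) × ℝ) ↦ p.2.1 ⬝ᵥ p.2.1) = fun p ↦ ∑ i, p.2.1 i * p.2.1 i := by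
    funext p; rfl
  rw [h]
  exact ContDiff.sum fun i _ ↦ (contDiff_pi.1 hv i).mul (contDiff_pi.1 hv i)

/-- **The restriction of the eigenpair map to a line in `(v, μ)`** has derivative
`((T₀ - λ) h - η n, 2⟨n, h⟩)` at `t = 0`. [folklore] -/
theorem hasDerivAt_eigenpairMap_line (T₀ : Matrix ι ι ℝ) (n h : ι → ℝ) (lam η : ℝ) :
    HasDerivAt (fun t : ℝ ↦ (T₀ *ᵥ (n + t • h) - (lam + t * η) • (n + t • h),
      (n + t • h) ⬝ᵥ (n + t • h)))
      (T₀ *ᵥ h - lam • h - η • n, 2 * (n ⬝ᵥ h)) 0 := by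
  have e1 : (fun t : ℝ ↦ T₀ *ᵥ (n + t • h) - (lam + t * η) • (n + t • h)) =
      fun t : ℝ ↦ (T₀ *ᵥ n - lam • n) + t • (T₀ *ᵥ h - lam • h - η • n) + t ^ 2 • (-(η • h)) := by
    funext t
    rw [mulVec_add, mulVec_smul]
    module
  have e2 : (fun t : ℝ ↦ (n + t • h) ⬝ᵥ (n + t • h)) =
      fun t : ℝ ↦ n ⬝ᵥ n + t * (2 * (n ⬝ᵥ h)) + t ^ 2 * (h ⬝ᵥ h) := by
    funext t
    simp only [add_dotProduct, dotProduct_add, smul_dotProduct, dotProduct_smul, smul_eq_mul,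
      dotProduct_comm h n]
    ring
  have hA : HasDerivAt (fun t : ℝ ↦ T₀ *ᵥ (n + t • h) - (lam + t * η) • (n + t • h))
      (T₀ *ᵥ h - lam • h - η • n) 0 := by
    rw [e1]
    have h1 := (((hasDerivAt_id (0 : ℝ)).smul_const (T₀ *ᵥ h - lam • h - η • n)).const_add
      (T₀ *ᵥ n - lam • n)).fun_add ((hasDerivAt_pow 2 (0 : ℝ)).smul_const (-(η • h)))
    simpa using h1
  have hB : HasDerivAt (fun t : ℝ ↦ (n + t • h) ⬝ᵥ (n + t • h)) (2 * (n ⬝ᵥ h)) 0 := by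
    rw [e2]
    have h2 := (((hasDerivAt_id (0 : ℝ)).mul_const (2 * (n ⬝ᵥ h))).const_add (n ⬝ᵥ n)).fun_add
      ((hasDerivAt_pow 2 (0 : ℝ)).mul_const (h ⬝ᵥ h))
    simpa using h2
  exact hA.prodMk hB

/-- **The partial derivative of the eigenpair map in `(v, μ)` at `(θ₀; n, λ)`**:
`(∂f/∂(v, μ)) (h, η) = ((T₀ - λ) h - η n, 2⟨n, h⟩)`. [folklore] -/
theorem fderiv_inr_eigenpairMap {T : ℝ → Matrix ι ι ℝ}
    (hT : ∀ i j, ContDiff ℝ ∞ fun θ ↦ T θ i j) (θ₀ : ℝ) (n : ι → ℝ) (lam : ℝ)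
    (h : ι → ℝ) (η : ℝ) :
    (fderiv ℝ (fun p : ℝ × ((ι → ℝ) × ℝ) ↦
        (T p.1 *ᵥ p.2.1 - p.2.2 • p.2.1, p.2.1 ⬝ᵥ p.2.1)) (θ₀, (n, lam)) ∘L
      ContinuousLinearMap.inr ℝ ℝ ((ι → ℝ) × ℝ)) (h, η) =
      (T θ₀ *ᵥ h - lam • h - η • n, 2 * (n ⬝ᵥ h)) := by
  set f : ℝ × ((ι → ℝ) × ℝ) → (ι → ℝ) × ℝ :=
    fun p ↦ (T p.1 *ᵥ p.2.1 - p.2.2 • p.2.1, p.2.1 ⬝ᵥ p.2.1) with hf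
  have hfd : HasFDerivAt f (fderiv ℝ f (θ₀, (n, lam))) (θ₀, (n, lam)) :=
    (((contDiff_eigenpairMap hT).differentiable (by simp)) _).hasFDerivAt
  have hF₀ : HasFDerivAt (fun p : (ι → ℝ) × ℝ ↦ f (θ₀, p))
      ((fderiv ℝ f (θ₀, (n, lam))).comp (ContinuousLinearMap.inr ℝ ℝ ((ι → ℝ) × ℝ)))
      (n, lam) :=
    hfd.comp (n, lam) (hasFDerivAt_prodMk_right θ₀ (n, lam))
  set ℓ : ℝ → (ι → ℝ) × ℝ := fun t ↦ (n + t • h, lam + t * η) with hℓ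
  have hℓ0 : ℓ 0 = (n, lam) := by simp [hℓ]
  have hℓd : HasDerivAt ℓ (h, η) 0 := by
    refine HasDerivAt.prodMk ?_ ?_
    · simpa using ((hasDerivAt_id (0 : ℝ)).smul_const h).const_add n
    · simpa using ((hasDerivAt_id (0 : ℝ)).mul_const η).const_add lam
  have hF₀' : HasFDerivAt (fun p : (ι → ℝ) × ℝ ↦ f (θ₀, p))
      ((fderiv ℝ f (θ₀, (n, lam))).comp (ContinuousLinearMap.inr ℝ ℝ ((ι → ℝ) × ℝ)))
      (ℓ 0) := by
    rw [hℓ0]; exact hF₀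
  have hcomp := HasFDerivAt.comp_hasDerivAt (x := (0 : ℝ)) (f := ℓ) hF₀' hℓd
  have hexp : HasDerivAt ((fun p : (ι → ℝ) × ℝ ↦ f (θ₀, p)) ∘ ℓ)
      (T θ₀ *ᵥ h - lam • h - η • n, 2 * (n ⬝ᵥ h)) 0 := by
    have e : ((fun p : (ι → ℝ) × ℝ ↦ f (θ₀, p)) ∘ ℓ) =
        fun t : ℝ ↦ (T θ₀ *ᵥ (n + t • h) - (lam + t * η) • (n + t • h),
          (n + t • h) ⬝ᵥ (n + t • h)) := by
      funext t; simp [hf, hℓ]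
    rw [e]
    exact hasDerivAt_eigenpairMap_line (T θ₀) n h lam η
  exact hcomp.unique hexp

/-- **Invertibility of the partial derivative** at a gapped unit eigenpair of a symmetric matrix
(injective by `gap_linearization_injective`, hence bijective in finite dimension).
[cite: Kato1966, II-§2.2] -/
theorem isInvertible_fderiv_inr_of_gap {T : ℝ → Matrix ι ι ℝ}
    (hT : ∀ i j, ContDiff ℝ ∞ fun θ ↦ T θ i j) {θ₀ : ℝ} {n : ι → ℝ} {lam : ℝ}
    (hsymm : (T θ₀).IsSymm) (hn1 : n ⬝ᵥ n = 1) (hTn : T θ₀ *ᵥ n = lam • n)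
    (hgap : ∀ v, v ⬝ᵥ n = 0 → v ≠ 0 → lam * (v ⬝ᵥ v) < v ⬝ᵥ T θ₀ *ᵥ v) :
    (fderiv ℝ (fun p : ℝ × ((ι → ℝ) × ℝ) ↦
        (T p.1 *ᵥ p.2.1 - p.2.2 • p.2.1, p.2.1 ⬝ᵥ p.2.1)) (θ₀, (n, lam)) ∘L
      ContinuousLinearMap.inr ℝ ℝ ((ι → ℝ) × ℝ)).IsInvertible := by
  set L := fderiv ℝ (fun p : ℝ × ((ι → ℝ) × ℝ) ↦
      (T p.1 *ᵥ p.2.1 - p.2.2 • p.2.1, p.2.1 ⬝ᵥ p.2.1)) (θ₀, (n, lam)) ∘L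
    ContinuousLinearMap.inr ℝ ℝ ((ι → ℝ) × ℝ) with hL
  have hinj : Injective L := by
    refine (injective_iff_map_eq_zero L).2 fun q hq ↦ ?_
    obtain ⟨h, η⟩ := q
    have hval := fderiv_inr_eigenpairMap hT θ₀ n lam h η
    rw [← hL] at hval
    rw [hval, Prod.mk_eq_zero] at hq
    obtain ⟨hq1, hq2⟩ := hq
    have h1 : T θ₀ *ᵥ h - lam • h = η • n := by rw [← sub_eq_zero, ← hq1]
    have h2 : h ⬝ᵥ n = 0 := by
      rw [dotProduct_comm]
      have : (2 : ℝ) ≠ 0 := two_ne_zero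
      exact (mul_eq_zero.1 hq2).resolve_left this
    obtain ⟨hh, hη⟩ := gap_linearization_injective hsymm hn1 hTn hgap h1 h2
    rw [hh, hη]; rfl
  have hbij : Bijective L :=
    ⟨hinj, (LinearMap.injective_iff_surjective (f := (L : ((ι → ℝ) × ℝ) →ₗ[ℝ]
      ((ι → ℝ) × ℝ)))).1 hinj⟩
  set e : ((ι → ℝ) × ℝ) ≃L[ℝ] ((ι → ℝ) × ℝ) :=
    (LinearEquiv.ofBijective (L : ((ι → ℝ) × ℝ) →ₗ[ℝ] ((ι → ℝ) × ℝ))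
      hbij).toContinuousLinearEquiv with he
  exact ⟨e, ContinuousLinearMap.ext fun q ↦ rfl⟩

/-! ### The smooth Perron branch -/


/-- **Smooth dependence of the positive bottom eigenvector on parameters.**  Let
`T : ℝ → Matrix ι ι ℝ` be an entrywise `C^∞` family of symmetric matrices, each with a unit
eigenvector with all entries positive whose eigenvalue lies strictly below the quadratic form on its
orthogonal complement (simple bottom eigenvalue, Perron vector).  Then there are `C^∞` maps
`N : ℝ → (ι → ℝ)`, `Λ : ℝ → ℝ` with `‖N θ‖ = 1`, `T θ N θ = Λ θ N θ`, `N θ > 0` entrywise and the gap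
`Λ θ ‖v‖² < ⟨v, T θ v⟩` on `(N θ)^⊥ ∖ 0`, for every `θ`.
[cite: Kato1966, II-§6.1–6.2 (with II-§1.1: in finite dimension a simple eigenvalue and its
eigenprojection depend analytically on the entries)] -/
theorem exists_contDiff_pos_bottom_eigenvector [Nonempty ι] {T : ℝ → Matrix ι ι ℝ}
    (hT : ∀ i j, ContDiff ℝ ∞ fun θ ↦ T θ i j) (hsymm : ∀ θ, (T θ).IsSymm)
    (hbot : ∀ θ, ∃ (n : ι → ℝ) (lam : ℝ), n ⬝ᵥ n = 1 ∧ T θ *ᵥ n = lam • n ∧ (∀ i, 0 < n i) ∧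
      ∀ v, v ⬝ᵥ n = 0 → v ≠ 0 → lam * (v ⬝ᵥ v) < v ⬝ᵥ T θ *ᵥ v) :
    ∃ (N : ℝ → ι → ℝ) (Λ : ℝ → ℝ), ContDiff ℝ ∞ N ∧ ContDiff ℝ ∞ Λ ∧
      (∀ θ, N θ ⬝ᵥ N θ = 1) ∧ (∀ θ, T θ *ᵥ N θ = Λ θ • N θ) ∧ (∀ θ i, 0 < N θ i) ∧
      (∀ θ v, v ⬝ᵥ N θ = 0 → v ≠ 0 → Λ θ * (v ⬝ᵥ v) < v ⬝ᵥ T θ *ᵥ v) := by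
  -- (1) the Perron pair at each `θ`
  have hex : ∀ θ, ∃ p : (ι → ℝ) × ℝ, p.1 ⬝ᵥ p.1 = 1 ∧ T θ *ᵥ p.1 = p.2 • p.1 ∧ (∀ i, 0 < p.1 i) ∧
      ∀ v, v ⬝ᵥ p.1 = 0 → v ≠ 0 → p.2 * (v ⬝ᵥ v) < v ⬝ᵥ T θ *ᵥ v := by
    intro θ
    obtain ⟨n, lam, hn1, hTn, hpos, hgap⟩ := hbot θ
    exact ⟨(n, lam), hn1, hTn, hpos, hgap⟩
  choose p hp1 hp2 hp3 hp4 using hex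
  set N : ℝ → ι → ℝ := fun θ ↦ (p θ).1 with hN
  set Λ : ℝ → ℝ := fun θ ↦ (p θ).2 with hΛ
  -- (2) uniqueness: a positive unit eigenpair is `(N θ, Λ θ)`
  have huniq : ∀ θ (m : ι → ℝ) (μ : ℝ), m ⬝ᵥ m = 1 → T θ *ᵥ m = μ • m → (∀ i, 0 < m i) →
      m = N θ ∧ μ = Λ θ := fun θ m μ h1 h2 h3 =>
    pos_eigenvector_unique (hsymm θ) (hp1 θ) (hp2 θ) (hp3 θ) (hp4 θ) h1 h2 h3
  -- (3) smoothness at every `θ₀` by the implicit function theorem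
  set f : ℝ × ((ι → ℝ) × ℝ) → (ι → ℝ) × ℝ :=
    fun q ↦ (T q.1 *ᵥ q.2.1 - q.2.2 • q.2.1, q.2.1 ⬝ᵥ q.2.1) with hf
  have hfs : ContDiff ℝ ∞ f := contDiff_eigenpairMap hT
  have hsmooth : ∀ θ₀, ContDiffAt ℝ ∞ (fun θ ↦ (N θ, Λ θ)) θ₀ := by
    intro θ₀
    set u : ℝ × ((ι → ℝ) × ℝ) := (θ₀, (N θ₀, Λ θ₀)) with hu
    have cdf : ContDiffAt ℝ ∞ f u := hfs.contDiffAt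
    have pn : (∞ : WithTop ℕ∞) ≠ 0 := by simp
    have if₂ : (fderiv ℝ f u ∘L ContinuousLinearMap.inr ℝ ℝ ((ι → ℝ) × ℝ)).IsInvertible :=
      isInvertible_fderiv_inr_of_gap hT (hsymm θ₀) (hp1 θ₀) (hp2 θ₀) (hp4 θ₀)
    set ψ := cdf.implicitFunction pn if₂ with hψ
    have hψs : ContDiffAt ℝ ∞ ψ θ₀ := cdf.contDiffAt_implicitFunction pn if₂
    have hψ0 : ψ θ₀ = (N θ₀, Λ θ₀) := cdf.implicitFunction_apply_self pn if₂
    have hfu : f u = (0, 1) := by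
      simp only [hf, hu]
      rw [hp2 θ₀, sub_self, hp1 θ₀]
    have hev : ∀ᶠ θ in 𝓝 θ₀, f (θ, ψ θ) = (0, 1) := by
      rw [← hfu]; exact cdf.eventually_apply_implicitFunction pn if₂
    -- continuity consequence: the continued vector keeps positive entries near `θ₀`
    have hψc : ContinuousAt ψ θ₀ := hψs.continuousAt
    have hev2 : ∀ᶠ θ in 𝓝 θ₀, ∀ i, 0 < (ψ θ).1 i := by
      refine eventually_all.2 fun i ↦ ?_
      have hc : ContinuousAt (fun θ ↦ (ψ θ).1 i) θ₀ :=
        ((continuous_apply i).continuousAt.comp (continuousAt_fst.comp hψc))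
      have h0 : 0 < (ψ θ₀).1 i := by rw [hψ0]; exact hp3 θ₀ i
      exact hc.eventually (lt_mem_nhds h0)
    -- hence `ψ = (N, Λ)` near `θ₀`
    have heq : (fun θ ↦ (N θ, Λ θ)) =ᶠ[𝓝 θ₀] ψ := by
      filter_upwards [hev, hev2] with θ h1 h2
      simp only [hf, Prod.mk.injEq] at h1
      obtain ⟨h1a, h1b⟩ := h1
      have heig : T θ *ᵥ (ψ θ).1 = (ψ θ).2 • (ψ θ).1 := sub_eq_zero.1 h1a
      obtain ⟨hm, hμ⟩ := huniq θ (ψ θ).1 (ψ θ).2 h1b heig h2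
      exact Prod.ext hm.symm hμ.symm
    exact hψs.congr_of_eventuallyEq heq
  have hNs : ContDiff ℝ ∞ N := contDiff_iff_contDiffAt.2 fun θ₀ ↦ (hsmooth θ₀).fst
  have hΛs : ContDiff ℝ ∞ Λ := contDiff_iff_contDiffAt.2 fun θ₀ ↦ (hsmooth θ₀).snd
  exact ⟨N, Λ, hNs, hΛs, hp1, hp2, hp3, hp4⟩

end Summit.HubbardSuperconductivity.HubbardSuperconductivity.Theorems.AnisotropyChord.PerronBranch

end
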